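import Summits.QuantumFields.BalabanUV.Beta.D1BFx.PackedDressingBridge

/-!
# `BalabanUV.Beta.D1BFx.PackedRoadSplit` — road «BF-x» for binder row D1, slot (K), chain steps (S-A1) ∘ (S-N): brick «ROAD-SPLIT AT THE PACK» —
# **THE N-GLUON WORD OF THE (K) IDENTITY IN THE END's `TOfLeg` CURRENCY AT THE Πᵀ_bm-DRESSED STENCILS.**  From an (A1)-identity of PART 3b's shape
# (`hessKer G₀ VM WM + hessKer (Cgh n a) ℒ ℒ₂ = hessKer (NlegRoad (n−1) a) 𝒱N 𝒲N + 2·hessKer idK1 𝒳 𝒳₂`, pointwise) whose N first table is a `G₀`-pack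
# `𝒱N = vertexOfK G₀ n T` of a self-localised stencil family `T` (leaf-03 g23's (D): `T := SN m a S`), the (S-N) split (`NlegKHessSplit.hessKer_NlegRoad_split`)
# and the pack bridge (`PackedDressingBridge.vertexOfK_G₀_eq_vertexOf`) give
# `hessKer G₀ VM WM = ¼·TOfLeg n (Ga n a) (blk (coProjBmAtK (toSite r) n T · ·) tt) (2•ffW 𝒲N) + legCross … + blockTerms … + 2·hessKer idK1 𝒳 𝒳₂ − hessKer (Cgh n a) ℒ ℒ₂`
# — the shape `RoadEndBFxDictPointwiseS.hdict_of_pointwise`'s `hptw` asks for, its gluon main word now an explicit `TOfLeg` over the road's ACTUAL dressed pack,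
# the sandwich ∕ block ∕ comb-FP ∕ ghost members being the named rest words of DICT-CHAIN-SPEC §2 (their unit-class rows are the (II) lanes').

HONEST DEPENDENCY (cell records, verbatim): «continuum YM on T⁴ ⇐ BetaPertH ∧ nine spine estimates (0/9 proved); BetaPertH ⇐ (D1) ∧ (D4) ∧
CAP+tail; G-an2-4 gates asym, D1 and NE2/3/4.»  HONEST FRAMING (cell contract, verbatim): «discharging `BetaPertH` makes Bałaban's UV stability
UNCONDITIONAL — a real constructive-QFT result; it is NOT the continuum limit and NOT the Clay problem.»  THIS MODULE DISCHARGES NOTHING of (K),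
of D1 or of the wall: [folklore] composition BY NAME of `NlegKHessSplit.hessKer_NlegRoad_split` (modulo `Spr (Ga n a)` — [B5] Prop. 1.2 ∧ (1.126)–(1.127)
content by name elsewhere), `NlegKHessSplit.hessKer_smul_leg_eq`, `PackedKernelSplit.ffV_vertexOf`, `ReducedKernelF.TOfLeg_eq`, «PACK-BRIDGE» §3.  The (A1)-identity
and the identification `𝒱N = vertexOfK G₀ n T` enter as HYPOTHESES (PART 3b ∕ PART 4 and leaf-03's (D) supply them).  No definition, no `def … : Prop`,
nothing cited, 0 sorry.  0 root-level binders of row D1 discharged; (K) NOT closed; NOT D1, NOT `BetaPertH`, NOT continuum, NOT Clay.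

ABSOLUTE RULE (cell charter, verbatim): «No internally-minted statement may enter as a cited fact. Every hypothesis is either kernel-proved in this
package or a verbatim quotation of a PUBLISHED theorem with page reference. The manuscript(s) under audit are NOT citable for their own disputed
steps — they are the thing under adjudication; programme-internal (2001/route/tribunal) claims are never citable.»

CONTENT (all [folklore]): `loc_of_vertexFamily`, **`gluonWord_eq_TOfLeg_coProj`** (the gluon word over `½•Ga` at a `G₀`-packed N table IS `¼·TOfLeg` at the dressed
stencils), **`hessKer_road_split_of_packed_identity`** (the displayed composition).
Unit `b2b-balaban-beta-d1-p2` (road owner, gen 18), 2026-08-22.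
-/

noncomputable section

namespace Summit.QuantumFields.BalabanUV.Beta.D1BFx.PackedRoadSplit

open scoped BigOperators
open Literature.MathematicalPhysics.QuantumFieldTheory.Balaban1983to89
open Literature.MathematicalPhysics.QuantumFieldTheory.Balaban1983to89.Beta
open ExpKernelCalculus (MKer BiLoc Decays hessKer VertexFamily)
open AffineAveraging (box toSite)
open OneStepResolventKernel (Fib KInv vertexOf LocStencil biLoc_mono)
open OneStepKernelFamily (KInvStep vertexOfK vertexFamily_vertexOfK)
open Summit.QuantumFields.BalabanUV.Beta.TameKernelCalculus (Spr Loc)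
open Summit.QuantumFields.BalabanUV.Beta.AxialDressingRooted (coDressKBmAt coProjBmAtK decays_coDressKBmAt_KInvStep)
open Summit.QuantumFields.BalabanUV.Beta.D1BFx.PackedKernelSplit (blk ffV ffW legCross blockTerms ffV_vertexOf)
open Summit.QuantumFields.BalabanUV.Beta.D1BFx.ReducedKernelF (TOfLeg TOfLeg_eq)
open Summit.QuantumFields.BalabanUV.Beta.D1BFx.CoarseGramInverse (multM)
open Summit.QuantumFields.BalabanUV.Beta.D1BFx.RWeightedLegPack (NlegRoad sandP)
open Summit.QuantumFields.BalabanUV.Beta.D1BFx.GluonLeg (Ga)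
open Summit.QuantumFields.BalabanUV.Beta.D1BFx.NlegKHessSplit (hessKer_NlegRoad_split hessKer_smul_leg_eq)
open Summit.QuantumFields.BalabanUV.Beta.D1BFx.PackedDressingBridge (vertexOfK_G₀_eq_vertexOf)

/-! ## §1 Localisation bookkeeping -/

section Loc

variable {D : ℕ} {F : Type*}

/-- [folklore] A vertex family is localised at every bond. -/
theorem loc_of_vertexFamily {V : Fin D → (Fin D → ℤ) → MKer D F} {N : ℕ} {C δ : ℝ} (hV : VertexFamily V N C δ) (hδ : 0 < δ) (μ : Fin D)
    (y : Fin D → ℤ) : Loc (V μ y) :=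
  ⟨_, _, C, δ, hδ, hV μ y⟩

end Loc

/-! ## §2 The gluon word at a `G₀`-packed N table -/

section Gluon

variable (m : ℕ) {a : ℝ} {r : Fin 4 → ℕ} (hr : r ∈ box (3 + 1) (m + 1))
include hr

/-- [folklore] **THE GLUON WORD OVER `½•Ga` AT A `G₀`-PACKED N TABLE IS `¼·TOfLeg` AT THE Πᵀ_bm-DRESSED STENCILS**: for a self-localised `T` and any second table `W`,
`hessKer (½•Ga (m+1) a) (ffV (vertexOfK G₀ (m+1) T)) (ffW W) μ ν z = (½)²·TOfLeg (m+1) (Ga (m+1) a) (fun κ u => blk (coProjBmAtK (toSite r) (m+1) T κ u) tt) (fun … => (½)⁻¹ • ffW W …) μ ν z`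
(`hessKer_smul_leg_eq` + «PACK-BRIDGE» `vertexOfK_G₀_eq_vertexOf` + `ffV_vertexOf` + `TOfLeg_eq`). -/
theorem gluonWord_eq_TOfLeg_coProj {T : Fin 4 → (Fin 4 → ℤ) → MKer 4 (Fib 3)} {CT δT : ℝ} (hT : LocStencil T CT δT) (hδT : 0 ≤ δT)
    (W : Fin 4 → (Fin 4 → ℤ) → Fin 4 → (Fin 4 → ℤ) → MKer 4 (Fib 3)) (μ ν : Fin 4) (z : Fin 4 → ℤ) :
    hessKer ((2 : ℝ)⁻¹ • Ga (m + 1) a) (ffV (vertexOfK (coDressKBmAt (toSite r) (m + 1) (KInvStep (d := 3) (m + 1) 0)) (m + 1) T)) (ffW W) μ ν z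
      = ((2 : ℝ)⁻¹) ^ 2 * TOfLeg (m + 1) (Ga (m + 1) a) (fun κ u => blk (coProjBmAtK (toSite r) (m + 1) T κ u) true true)
          (fun μ' y ν' y' => ((2 : ℝ)⁻¹)⁻¹ • ffW W μ' y ν' y') μ ν z := by
  have hV : vertexOfK (coDressKBmAt (toSite r) (m + 1) (KInvStep (d := 3) (m + 1) 0)) (m + 1) T
      = vertexOf (N := m + 1) (coProjBmAtK (toSite r) (m + 1) T) :=
    funext fun μ' => funext fun y => vertexOfK_G₀_eq_vertexOf hr hT hδT μ' y
  rw [hessKer_smul_leg_eq _ (by norm_num) _ _ _ μ ν z, hV, ffV_vertexOf, TOfLeg_eq]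

end Gluon

/-! ## §3 The (K) identity split at the pack -/

section Split

variable (m : ℕ) {a : ℝ} {r : Fin 4 → ℕ} (hr : r ∈ box (3 + 1) (m + 1))
include hr

/-- [folklore] **«ROAD-SPLIT AT THE PACK»**: from an (A1)-identity of PART 3b's shape
`hessKer G₀ VM WM μ ν z + hessKer (Cgh (m+1) a) ℒ ℒ₂ μ ν z = hessKer (NlegRoad m a) 𝒱N 𝒲N μ ν z + 2·hessKer idK1 𝒳 𝒳₂ μ ν z` (any legs `Lgh Lfp`, written generically),
the identification `𝒱N = vertexOfK G₀ (m+1) T` of the N first table as a `G₀`-pack of a self-localised stencil family `T` (leaf-03's (D): `T := SN m a S`),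
localisation of `𝒲N` at every pair of bonds, and `Spr (Ga (m+1) a)`:
`hessKer G₀ VM WM μ ν z = (½)²·TOfLeg (m+1) (Ga (m+1) a) (blk (coProjBmAtK (toSite r) (m+1) T · ·) tt) ((½)⁻¹ • ffW 𝒲N) μ ν z + legCross (½•Ga) ((−½)•sandwich_ff) (ffV 𝒱N) (ffW 𝒲N) μ ν z
+ blockTerms (NlegRoad m a) 𝒱N 𝒲N μ ν z + 2·hessKer Lfp 𝒳 𝒳₂ μ ν z − hessKer Lgh ℒ ℒ₂ μ ν z` — the `hptw` shape: main gluon word + named rest words. -/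
theorem hessKer_road_split_of_packed_identity (hGa : Spr (Ga (m + 1) a))
    {Fg Ff : Type*} [Fintype Fg] [Fintype Ff]
    (G₀' : MKer 4 (Fib 3)) (VM : Fin 4 → (Fin 4 → ℤ) → MKer 4 (Fib 3))
    (WM : Fin 4 → (Fin 4 → ℤ) → Fin 4 → (Fin 4 → ℤ) → MKer 4 (Fib 3))
    (Lgh : MKer 4 Fg) (ℒ : Fin 4 → (Fin 4 → ℤ) → MKer 4 Fg) (ℒ₂ : Fin 4 → (Fin 4 → ℤ) → Fin 4 → (Fin 4 → ℤ) → MKer 4 Fg)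
    (Lfp : MKer 4 Ff) (𝒳 : Fin 4 → (Fin 4 → ℤ) → MKer 4 Ff) (𝒳₂ : Fin 4 → (Fin 4 → ℤ) → Fin 4 → (Fin 4 → ℤ) → MKer 4 Ff)
    (𝒱N : Fin 4 → (Fin 4 → ℤ) → MKer 4 (Fib 3)) (𝒲N : Fin 4 → (Fin 4 → ℤ) → Fin 4 → (Fin 4 → ℤ) → MKer 4 (Fib 3))
    (μ ν : Fin 4) (z : Fin 4 → ℤ)
    (hId : hessKer G₀' VM WM μ ν z + hessKer Lgh ℒ ℒ₂ μ ν z = hessKer (NlegRoad m a) 𝒱N 𝒲N μ ν z + 2 * hessKer Lfp 𝒳 𝒳₂ μ ν z)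
    {T : Fin 4 → (Fin 4 → ℤ) → MKer 4 (Fib 3)} {CT δT : ℝ} (hT : LocStencil T CT δT) (hδT : 0 < δT)
    (h𝒱N : 𝒱N = vertexOfK (coDressKBmAt (toSite r) (m + 1) (KInvStep (d := 3) (m + 1) 0)) (m + 1) T)
    (hWN : ∀ μ' y ν' y', Loc (𝒲N μ' y ν' y')) :
    hessKer G₀' VM WM μ ν z
      = ((2 : ℝ)⁻¹) ^ 2 * TOfLeg (m + 1) (Ga (m + 1) a) (fun κ u => blk (coProjBmAtK (toSite r) (m + 1) T κ u) true true)
            (fun μ' y ν' y' => ((2 : ℝ)⁻¹)⁻¹ • ffW 𝒲N μ' y ν' y') μ ν z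
        + legCross ((2 : ℝ)⁻¹ • Ga (m + 1) a)
            ((-(2 : ℝ)⁻¹) • blk (sandP (m + 1) (Ga (m + 1) a) (multM (m + 1) (2 * a / ((m + 1 : ℕ) : ℝ) ^ 8) 2)) true true)
            (ffV 𝒱N) (ffW 𝒲N) μ ν z
        + blockTerms (NlegRoad m a) 𝒱N 𝒲N μ ν z
        + 2 * hessKer Lfp 𝒳 𝒳₂ μ ν z - hessKer Lgh ℒ ℒ₂ μ ν z := by
  -- the N first table is localised everywhere (a vertex family through the decaying `G₀`)
  obtain ⟨δG, CG, hδG, hCG, hG⟩ := decays_coDressKBmAt_KInvStep (d := 3) hr 0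
  have hCT : 0 ≤ CT := (hT 0 0).nonneg (Sum.inl 0)
  have hT' : LocStencil T CT (min δT δG) := fun κ u => biLoc_mono (hT κ u) hCT (min_le_left δT δG)
  have hVfam := vertexFamily_vertexOfK (N := m + 1) hG hCG hT' (lt_min hδT hδG) (min_le_right δT δG)
  have hVN : ∀ μ' y, Loc (𝒱N μ' y) := fun μ' y => by
    rw [h𝒱N]; exact loc_of_vertexFamily hVfam (half_pos (lt_min hδT hδG)) μ' y
  -- (S-N) split of the right member, then the gluon word at the pack
  have hsplit := hessKer_NlegRoad_split m hGa hVN hWN μ ν z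
  have hgl := gluonWord_eq_TOfLeg_coProj m hr (a := a) hT hδT.le 𝒲N μ ν z
  rw [← h𝒱N] at hgl
  rw [hsplit, hgl] at hId
  linarith

end Split

end Summit.QuantumFields.BalabanUV.Beta.D1BFx.PackedRoadSplit

end
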